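import Summits.QuantumFields.QCD.Theses.CounterexampleMustBeHot
import Literature.MathematicalPhysics.QuantumFieldTheory.QCDGoldstoneBound
import HarnessLib.Audit

/-!
# Line `chiral_calibrated_convergence` — skeleton for crux `ChiralCalibratedConvergence` (item stmt-QuantumFields-18044)

Route `route-QuantumFields-CounterexampleMustBeHot` (sub-problem QCD), crux decl
`Summit.QuantumFields.QCD.Theses.CounterexampleMustBeHot.ChiralCalibratedConvergence` (rank 5) — piece 1 (the UV half,
the only NEW piece) of the typed decomposition of the deciding crux `ChiralContinuumComplement`
(stmt-QuantumFields-17304; skeleton `Lines/pieces.lean`).  crux-strategist `cstrat-stmt-QuantumFields-17304-r1`, 2026-08-17.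

THE CRUX.  For `N_f ∈ {2,3}` and EVERY `reg` carrying the chiral lattice half (`HasMassScaling`, `IsChiralAtZero`,
two-loop asymptotic scaling, and at every positive tuple the physical branch and a volume-uniform lattice gap) there
are `φ` strictly increasing and `reg₁` REINDEXED FROM `reg` ALONG `φ` (`a, β, m_crit, Z_m` composed with `φ`; volumes
only enlarged) which is again chiral at zero and carries ONE calibrated species family whose calibration bites, with a
glue `κ₃`-witness, and whose calibrated lattice `n`-point functions all converge along the reindexed sequence, at every
positive tuple.

THE LINE = GOLDSTONE SUBSEQUENCE ∘ VOLUME UPGRADE ∘ CALIBRATED CONTROL ∘ DIAGONAL EXTRACTION.  Four stubs, each a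
genuine lemma over existing declarations; the composition `ChiralCalibratedConvergence_of` is sorry-free:

* `stub_chiralGoldstoneSubsequence : ChiralGoldstoneSubsequence` — **(A) the chiral limit of the GIVEN gapped sequence
  is reached through light states, EVENTUALLY, along a subsequence** (lattice-spectral; open / L).  From the crux's
  hypotheses on `reg`: some subsequence `reg.restrict φ₀` has the eventual Goldstone lower bound `HasGoldstoneBound`
  (Literature `QCDGoldstoneBound.lean`: for every rate `ε` one channel at one positive tuple is bounded BELOW by
  `c e^{−μ a_k n_k}`, `μ < ε`, `a_k n_k → ∞`, for ALL large `k`) — the subsequence-stable form of chirality.  Why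
  plausibly true: at the tuple `m_ε` of `IsChiralAtZero` the gap clause (rate `Δ(m_ε) > 0`, eventually) bounds the
  prefactors, so every violation of the rate-`ε` bound is a SLOW DECAY with `a_k n_k → ∞` (bookkeeping of
  `QCDScheme.not_hasLatticeMassGap_of_frequently_slow_decay` run backwards); the violation index sets for `ε_j ↓ 0`
  are sublevel sets of ONE quantity — the offset of `m_crit(k)` from the chiral line in units `a_k/Z_m(k)` — hence
  nested, and a diagonal choice along them is the Goldstone subsequence.  Why it might fail: nestedness is physics
  (monotonicity of the pion mass in the offset), not logic; an Aoki finger / first-order jump (Sharpe–Singleton) makes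
  the light states discontinuous in the offset.
* `stub_goldstoneVolumeUpgrade : GoldstoneVolumeUpgrade` — **(V) enlarge the volumes to polynomial growth keeping the
  Goldstone bound** (M).  Same `a, β, m_crit, Z_m`; `L_k ≤ L'_k` with `a_k^{−θ} ≤ a_k L'_k` eventually; the Goldstone
  bound re-witnessed on tori `S_k ≥ L'_k`.  (Asymptotic scaling, branch and the lattice gap transport for free — the
  gap quantifies over all tori `S ≥ L_k` — PROVED in §3; only the Goldstone LOWER bound on larger tori is new
  information: thermodynamic-limit insensitivity of one two-point lower bound at fixed physical time, plausible from the
  uniform gap, `O(e^{−Δ a_k L_k})` wrap-around.)  Needed because the periodic seam of the box-truncated smearing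
  against Schwartz tails (DiagonalSpine stmt-14654, kit j013894) forbids `k`-uniform Schwartz bounds on slowly growing
  boxes.
* `stub_calibratedControl : CalibratedControl` — **(B1) THE UV CORE: calibrated `k`-uniform control on an honestly
  chiral, uniformly gapped, asymptotically free, polynomial-volume sequence** (open / XL).  ONE calibrated species
  family `𝒞` over `reg` with: LIVENESS at every positive tuple (calibration bites eventually for `glue` and the
  flavour-changing `pseudoRe f g`; glue `κ₃`-witness eventually) — the Goldstone bound pins the offset of `m_crit` to
  the chiral line, so the quarks are NOT decoupled and the calibrating connected functions are positive reals by RP of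
  the `r = 1` Wilson transfer matrix (`κ < 1/6`) plus non-degeneracy; GLOBAL TIGHTNESS (`k`-uniform E0′-type bounds
  `‖S_k‖ ≤ α (n!)^β ‖F‖_{n s}` for ALL off-diagonal Schwartz tensors, locally uniformly on compacts of positive tuples,
  eventually — under polynomial volume growth the seam contribution `a_k⁻¹` of a tensor touching the box face at
  physical radius `a_k L_k ≥ a_k^{−θ}` is paid by its Schwartz weight `(a_k L_k)^{−s}` once `sθ ≥ 1`); and
  MASS-LIPSCHITZ continuity on compacts for compactly supported tuples (Feynman–Hellmann in the bare mass: volume-summed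
  `ψ̄ψ` insertions summable by the uniform gap).  This is DiagonalSpine's CalibratedTightness (stmt-14675) +
  MassEquicontinuity (stmt-14676) with their hypothesis H4 (lattice non-decoupling) replaced by its physical source, the
  Goldstone bound: a prover may bridge by ONE lemma "Goldstone bound + gap ⇒ H4" and cite those items.  Why it might
  fail: `k`-uniform E0′ bounds with light Wilson quarks exist for no 4D gauge theory (Balaban: pure YM, effective
  actions only); the `κ₃` lower bound uniform in `k` is a genuine non-Gaussianity input.
* `stub_diagonalExtraction : DiagonalExtraction` — **(B2) the soft half: one diagonal subsequence for all masses**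
  (L; provable with work).  From liveness + global tightness + mass-Lipschitz: a strictly increasing `ψ` and a
  calibrated family `𝒞₁` over `reg.restrict ψ` (the reindexed `𝒞`) whose calibration bites, with `κ₃`, and whose
  lattice `n`-point functions CONVERGE along the full reindexed sequence at every positive tuple — diagonal lemma over
  the countable index (arity × species strings × a countable Schwartz-dense set of off-diagonal real tensor tuples ×
  a countable dense set of positive tuples), then density in `F` by the uniform tightness modulus (multilinearity) and
  density in `m` by the uniform Lipschitz modulus; liveness and `κ₃` are `∀ᶠ` clauses and ride along `ψ`.  No
  chirality here: it is carried by the glue through `HasGoldstoneBound.restrict`.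

`ChiralCalibratedConvergence_of : A → V → B1 → B2 → ChiralCalibratedConvergence` (hypotheses under their stub-keyed
aliases `__Registered.stub_*`, §2b) is kernel-checked, no `sorry`, standard axioms, and is not a one-line seam: (A)
yields the Goldstone subsequence `reg₀ := reg.restrict φ₀`; mass scaling / asymptotic scaling / branch + gap are
TRANSPORTED to `reg₀` (§3, tail properties); (V) yields `reg₁` (same bare data, larger polynomial volumes, Goldstone
bound) and the same clauses are transported across the volume enlargement (§3, the gap is volume-monotone); (B1) yields
`𝒞` with liveness / tightness / Lipschitz; (B2) yields `ψ` and `𝒞₂` over `reg₁.restrict ψ` with the per-tuple clauses;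
the witness is `(φ₀ ∘ ψ, reg₁.restrict ψ, 𝒞₂)`: the four data ties and the volume inequality are equalities of
composed sequences, and chirality of the final regularisation is `(HasGoldstoneBound.restrict …).isChiralAtZero`.
Load-bearing: all four (drop A: no subsequence-stable chirality, the extraction may kill `IsChiralAtZero`; drop V: B1 is
false on slowly growing boxes; drop B1: nothing to extract; drop B2: no convergence).

Disproof used: none exists for stmt-QuantumFields-18044 / 17304 (`ledger crux ls`: no `Disproof.lean`); negatives index
(`ledger negatives --problem QuantumFields`) has no statement about calibrated convergence, Goldstone subsequences or
volume upgrades; the refuted DiagonalSpine generations (coincident tuples, silent calibration at coarse `k`, periodic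
seam on slow volumes) are honoured: tightness is asked on ⁰𝒮-off-diagonal tensors, eventually in `k`, under polynomial
volume growth (V); no absolute constant is fixed.
-/

noncomputable section

namespace Summit.QuantumFields.QCD.Cruxes.ChiralContinuumComplement.ChiralSubsequence

open Filter Topology
open Literature.MathematicalPhysics.QuantumFieldTheory Literature.MathematicalPhysics.QuantumLattice
  Literature.MathematicalPhysics.AQFT
open Summit.QuantumFields.QCD.Theses.CounterexampleMustBeHot

variable {Nf : ℕ}

/-! ## §0 Currency (statement abbreviations over existing declarations) -/

/-- The gapped-lattice data of the chiral lattice half at EVERY positive tuple: bare masses eventually on the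
physical branch and a volume-uniform lattice gap (verbatim the last antecedent of the crux). -/
def GapData (reg : QCDRegularisation Nf) : Prop :=
  ∀ m : Fin Nf → ℝ, (∀ f, 0 < m f) →
    (∀ f, ∀ᶠ k in Filter.atTop, -1 < (reg.scheme m 0 0).mq f k) ∧ ∃ Δ > 0, (reg.scheme m 0 0).HasLatticeMassGap Δ

/-- Polynomial volume growth in physical units: `a_k^{−θ} ≤ a_k L_k` eventually, for some `θ > 0`. -/
def PolyVolume (reg : QCDRegularisation Nf) : Prop :=
  ∃ θ : ℝ, 0 < θ ∧ ∀ᶠ k in Filter.atTop, reg.a k ^ (-θ) ≤ reg.a k * (reg.L k : ℝ)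

/-- The calibration of `𝒞` BITES at the tuple `m`, eventually: the calibrated reference two-point functions of `glue`
and of every flavour-changing `pseudoRe f g` equal `1` (hypotheses 5–6 of `ConvergentOSClosure`, verbatim). -/
def Bites {reg : QCDRegularisation Nf} (𝒞 : CalibratedSpeciesFamily reg) (m : Fin Nf → ℝ) : Prop :=
  (∀ᶠ k in Filter.atTop, (𝒞.scheme m).twoPoint k QCDField.glue QCDField.glue (thetaTest 4 𝒞.f₀) 𝒞.f₀ = 1) ∧
    (∀ f g : Fin Nf, f ≠ g → ∀ᶠ k in Filter.atTop,
      (𝒞.scheme m).twoPoint k (QCDField.pseudoRe f g) (QCDField.pseudoRe f g) (thetaTest 4 𝒞.f₀) 𝒞.f₀ = 1)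

/-- The glue `κ₃`-witness of `𝒞` at the tuple `m` (hypothesis 7 of `ConvergentOSClosure`, verbatim): the connected
three-point function of `glue` on three time-separated slabs stays `≥ ε > 0` eventually. -/
def Kappa3 {reg : QCDRegularisation Nf} (𝒞 : CalibratedSpeciesFamily reg) (m : Fin Nf → ℝ) : Prop :=
  ∃ f g h : SchwartzMap (EuclideanSpace ℝ (Fin 4)) ℝ, tsupport (f : EuclideanSpace ℝ (Fin 4) → ℝ) ⊆ {x | x 0 < 0} ∧ tsupport (g : EuclideanSpace ℝ (Fin 4) → ℝ) ⊆ {x | 0 < x 0 ∧ x 0 < 1} ∧ tsupport (h : EuclideanSpace ℝ (Fin 4) → ℝ) ⊆ {x | 1 < x 0} ∧ ∃ ε > (0 : ℝ), ∀ᶠ k in Filter.atTop, ε ≤ ‖qcdLatticeSchwinger (𝒞.scheme m) k 3 ![QCDField.glue, QCDField.glue, QCDField.glue] ![f, g, h] - qcdLatticeSchwinger (𝒞.scheme m) k 1 ![QCDField.glue] ![f] * qcdLatticeSchwinger (𝒞.scheme m) k 2 ![QCDField.glue, QCDField.glue] ![g, h] - qcdLatticeSchwinger (𝒞.scheme m)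 k 1 ![QCDField.glue] ![g] * qcdLatticeSchwinger (𝒞.scheme m) k 2 ![QCDField.glue, QCDField.glue] ![f, h] - qcdLatticeSchwinger (𝒞.scheme m) k 1 ![QCDField.glue] ![h] * qcdLatticeSchwinger (𝒞.scheme m) k 2 ![QCDField.glue, QCDField.glue] ![f, g] + 2 * (qcdLatticeSchwinger (𝒞.scheme m) k 1 ![QCDField.glue] ![f] * qcdLatticeSchwinger (𝒞.scheme m) k 1 ![QCDField.glue] ![g] * qcdLatticeSchwinger (𝒞.scheme m) k 1 ![QCDField.glue] ![h])‖

/-- Full-sequence convergence of every calibrated lattice `n`-point function of `𝒞` at the tuple `m` on off-diagonal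
tensors (hypothesis 8 of `ConvergentOSClosure`, verbatim). -/
def Converges {reg : QCDRegularisation Nf} (𝒞 : CalibratedSpeciesFamily reg) (m : Fin Nf → ℝ) : Prop :=
  ∀ n : ℕ, n ≠ 0 → ∀ (σ : Fin n → QCDField Nf) (f : Fin n → SchwartzMap (EuclideanSpace ℝ (Fin 4)) ℝ)
    (F : SchwartzMap (Fin n → EuclideanSpace ℝ (Fin 4)) ℂ), IsTensorOf F (fun i => ofRealTest (f i)) →
      IsOffDiagonal F → ∃ c : ℂ, Filter.Tendsto (fun k : ℕ => qcdLatticeSchwinger (𝒞.scheme m) k n σ f)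
        Filter.atTop (nhds c)

/-- LIVENESS of `𝒞`: at every positive tuple the calibration bites and the glue `κ₃`-witness holds. -/
def Live {reg : QCDRegularisation Nf} (𝒞 : CalibratedSpeciesFamily reg) : Prop :=
  ∀ m : Fin Nf → ℝ, (∀ f, 0 < m f) → Bites 𝒞 m ∧ Kappa3 𝒞 m

/-- GLOBAL TIGHTNESS of `𝒞`: `k`-uniform E0′-type bounds for ALL off-diagonal Schwartz tensors, locally uniformly on
compacts of positive tuples, eventually in `k` (the ⁰𝒮 form; one Schwartz index `s` and constants `α, β` per compact). -/
def TightGlobal {reg : QCDRegularisation Nf} (𝒞 : CalibratedSpeciesFamily reg) : Prop :=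
  ∀ K : Set (Fin Nf → ℝ), IsCompact K → K ⊆ {m | ∀ fl, 0 < m fl} →
    ∃ (s : ℕ) (α β : ℝ), ∀ᶠ k in Filter.atTop, ∀ m ∈ K, ∀ (n : ℕ) (σ : Fin n → QCDField Nf)
      (f : Fin n → SchwartzMap (EuclideanSpace ℝ (Fin 4)) ℝ) (F : SchwartzMap (Fin n → EuclideanSpace ℝ (Fin 4)) ℂ),
      IsTensorOf F (fun i => ofRealTest (f i)) → IsOffDiagonal F →
        ‖qcdLatticeSchwinger (𝒞.scheme m) k n σ f‖ ≤ α * (n.factorial : ℝ) ^ β * schwartzNorm (n * s) F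

/-- MASS-LIPSCHITZ continuity of `𝒞` (verbatim the conclusion of `DiagonalSpine.MassEquicontinuity`): for compactly
supported off-diagonal real tensor tuples, `m ↦ S_k(m)` is Lipschitz on compacts of positive tuples, eventually and
uniformly in `k`. -/
def MassLipschitz {reg : QCDRegularisation Nf} (𝒞 : CalibratedSpeciesFamily reg) : Prop :=
  ∀ n : ℕ, n ≠ 0 → ∀ (σ : Fin n → QCDField Nf) (f : Fin n → SchwartzMap (EuclideanSpace ℝ (Fin 4)) ℝ)
    (F : SchwartzMap (Fin n → EuclideanSpace ℝ (Fin 4)) ℂ), IsTensorOf F (fun i => ofRealTest (f i)) →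
      IsOffDiagonal F → ∀ R : ℝ, (∀ i, tsupport (f i) ⊆ Metric.closedBall 0 R) →
        ∀ K : Set (Fin Nf → ℝ), IsCompact K → K ⊆ {m | ∀ fl, 0 < m fl} →
          ∃ C : ℝ, ∀ᶠ k in Filter.atTop, ∀ m ∈ K, ∀ m' ∈ K,
            ‖qcdLatticeSchwinger (𝒞.scheme m) k n σ f - qcdLatticeSchwinger (𝒞.scheme m') k n σ f‖ ≤ C * ‖m - m'‖

/-! ## §1 The four stub statements -/

/-- **(A) Goldstone subsequence.**  From the chiral lattice half on `reg`: along some subsequence the reindexed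
regularisation has the EVENTUAL Goldstone lower bound (`HasGoldstoneBound`, subsequence-stable chirality). -/
def ChiralGoldstoneSubsequence : Prop :=
  ∀ Nf : ℕ, Nf = 2 ∨ Nf = 3 → ∀ reg : QCDRegularisation Nf, reg.HasMassScaling → reg.IsChiralAtZero →
    (reg.scheme 0 0 0).HasAsymptoticScaling → GapData reg →
      ∃ (φ : ℕ → ℕ) (hφ : StrictMono φ), (reg.restrict φ hφ.tendsto_atTop).HasGoldstoneBound

/-- **(V) Volume upgrade keeping the Goldstone bound.**  Same `a, β, m_crit, Z_m`; volumes enlarged to polynomial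
growth in physical units; the Goldstone bound re-witnessed on the larger tori. -/
def GoldstoneVolumeUpgrade : Prop :=
  ∀ Nf : ℕ, Nf = 2 ∨ Nf = 3 → ∀ reg : QCDRegularisation Nf, (reg.scheme 0 0 0).HasAsymptoticScaling →
    GapData reg → reg.HasGoldstoneBound →
      ∃ reg' : QCDRegularisation Nf, reg'.a = reg.a ∧ reg'.β = reg.β ∧ reg'.mcrit = reg.mcrit ∧ reg'.Zm = reg.Zm ∧
        (∀ k, reg.L k ≤ reg'.L k) ∧ PolyVolume reg' ∧ reg'.HasGoldstoneBound

/-- **(B1) Calibrated control — the UV core.**  On an honestly chiral (Goldstone-bounded), uniformly gapped,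
asymptotically free sequence with polynomial volumes: ONE calibrated species family that is live (biting calibration and
glue `κ₃` at every positive tuple), globally tight on ⁰𝒮, and mass-Lipschitz. -/
def CalibratedControl : Prop :=
  ∀ Nf : ℕ, Nf = 2 ∨ Nf = 3 → ∀ reg : QCDRegularisation Nf, reg.HasMassScaling →
    (reg.scheme 0 0 0).HasAsymptoticScaling → GapData reg → reg.HasGoldstoneBound → PolyVolume reg →
      ∃ 𝒞 : CalibratedSpeciesFamily reg, Live 𝒞 ∧ TightGlobal 𝒞 ∧ MassLipschitz 𝒞

/-- **(B2) Diagonal extraction — the soft half.**  From a live, globally tight, mass-Lipschitz calibrated family (any `N_f`, any regularisation —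
no physics): one strictly increasing reindexing along which a calibrated family over the reindexed regularisation is live and ALL its
lattice `n`-point functions converge, at every positive tuple. -/
def DiagonalExtraction : Prop :=
  ∀ (Nf : ℕ) (reg : QCDRegularisation Nf) (𝒞 : CalibratedSpeciesFamily reg), Live 𝒞 → TightGlobal 𝒞 →
    MassLipschitz 𝒞 →
      ∃ (ψ : ℕ → ℕ) (hψ : StrictMono ψ) (𝒞₁ : CalibratedSpeciesFamily (reg.restrict ψ hψ.tendsto_atTop)),
        ∀ m : Fin Nf → ℝ, (∀ f, 0 < m f) → Bites 𝒞₁ m ∧ Kappa3 𝒞₁ m ∧ Converges 𝒞₁ m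

/-! ## §2 The registered stubs (the ONLY `sorry`s of this file) -/

/-- (A) Goldstone subsequence — open / L (lattice-spectral). -/
theorem stub_chiralGoldstoneSubsequence : ChiralGoldstoneSubsequence := by
  sorry

/-- (V) volume upgrade keeping the Goldstone bound — M. -/
theorem stub_goldstoneVolumeUpgrade : GoldstoneVolumeUpgrade := by
  sorry

/-- (B1) calibrated control (liveness + global tightness + mass-Lipschitz) — open / XL, the hardest stub. -/
theorem stub_calibratedControl : CalibratedControl := by
  sorry

/-- (B2) diagonal extraction — L, provable with work. -/
theorem stub_diagonalExtraction : DiagonalExtraction := by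
  sorry

/-! ## §2b Stub-keyed aliases of the four statements (the hypotheses of `ChiralCalibratedConvergence_of`)

The native skeleton audit admits a hypothesis of the skeleton theorem only if its head constant is a registered
obligation or is NAMED like a declared stub; `__Registered.stub_X` is the statement of `stub_X` under that name
(device of `Cruxes/QuasilocalAfterBlocking/Lines/birth.lean`).  Each alias is `rfl`-equal to its statement. -/
namespace __Registered

/-- Alias of `ChiralGoldstoneSubsequence`. -/
abbrev stub_chiralGoldstoneSubsequence : Prop := ChiralGoldstoneSubsequence
/-- Alias of `GoldstoneVolumeUpgrade`. -/
abbrev stub_goldstoneVolumeUpgrade : Prop := GoldstoneVolumeUpgrade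
/-- Alias of `CalibratedControl`. -/
abbrev stub_calibratedControl : Prop := CalibratedControl
/-- Alias of `DiagonalExtraction`. -/
abbrev stub_diagonalExtraction : Prop := DiagonalExtraction

end __Registered

/-! ## §3 Glue (no `sorry` below this line): tail properties along subsequences and across volume enlargements -/

section Glue

variable (reg : QCDRegularisation Nf) (φ : ℕ → ℕ) (hφ : StrictMono φ)

/-- `HasMassScaling` passes to every subsequence. -/
theorem hasMassScaling_restrict (h : reg.HasMassScaling) : (reg.restrict φ hφ.tendsto_atTop).HasMassScaling := by
  obtain ⟨c, hc, ht⟩ := h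
  exact ⟨c, hc, ht.comp hφ.tendsto_atTop⟩

/-- Two-loop asymptotic scaling passes to every subsequence. -/
theorem hasAsymptoticScaling_restrict (h : (reg.scheme 0 0 0).HasAsymptoticScaling) :
    ((reg.restrict φ hφ.tendsto_atTop).scheme 0 0 0).HasAsymptoticScaling := by
  obtain ⟨Λ, hΛ, ht⟩ := h
  exact ⟨Λ, hΛ, ht.comp hφ.tendsto_atTop⟩

/-- Branch + gap at every positive tuple pass to every subsequence (`∀ᶠ` clauses with `k`-uniform constants). -/
theorem gapData_restrict (h : GapData reg) : GapData (reg.restrict φ hφ.tendsto_atTop) := by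
  intro m hm
  obtain ⟨hbr, Δ, hΔ, hgap⟩ := h m hm
  refine ⟨fun f => hφ.tendsto_atTop.eventually (hbr f), Δ, hΔ, fun R R' A B => ?_⟩
  obtain ⟨C, hC⟩ := hgap R R' A B
  exact ⟨C, hφ.tendsto_atTop.eventually hC⟩

variable {reg}

/-- `HasMassScaling` reads only `a` and `Z_m`. -/
theorem hasMassScaling_of_eq {reg' : QCDRegularisation Nf} (ha : reg'.a = reg.a) (hZ : reg'.Zm = reg.Zm)
    (h : reg.HasMassScaling) : reg'.HasMassScaling := by
  obtain ⟨c, hc, ht⟩ := h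
  refine ⟨c, hc, ?_⟩
  have hfun : (fun k => reg'.Zm k / Real.log (1 / reg'.a k ^ 2) ^ massExponent Nf) =
      fun k => reg.Zm k / Real.log (1 / reg.a k ^ 2) ^ massExponent Nf := by
    funext k; rw [ha, hZ]
  rw [hfun]
  exact ht

/-- Asymptotic scaling reads only `β` and `a`. -/
theorem hasAsymptoticScaling_of_eq {reg' : QCDRegularisation Nf} (ha : reg'.a = reg.a) (hβ : reg'.β = reg.β)
    (h : (reg.scheme 0 0 0).HasAsymptoticScaling) : (reg'.scheme 0 0 0).HasAsymptoticScaling := by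
  obtain ⟨Λ, hΛ, ht⟩ := h
  refine ⟨Λ, hΛ, ?_⟩
  have hfun : (fun k => (reg'.scheme 0 0 0).β k - afBeta Nf Λ ((reg'.scheme 0 0 0).a k)) =
      fun k => (reg.scheme 0 0 0).β k - afBeta Nf Λ ((reg.scheme 0 0 0).a k) := by
    funext k; simp [QCDRegularisation.scheme, ha, hβ]
  rw [hfun]
  exact ht

/-- Branch + gap read `a, β, m_crit, Z_m` and are MONOTONE under volume enlargement (the gap quantifies over all
tori `S ≥ L_k`). -/
theorem gapData_of_eq_of_le {reg' : QCDRegularisation Nf} (ha : reg'.a = reg.a) (hβ : reg'.β = reg.β)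
    (hmc : reg'.mcrit = reg.mcrit) (hZ : reg'.Zm = reg.Zm) (hL : ∀ k, reg.L k ≤ reg'.L k) (h : GapData reg) :
    GapData reg' := by
  intro m hm
  obtain ⟨hbr, Δ, hΔ, hgap⟩ := h m hm
  refine ⟨fun f => (hbr f).mono fun k hk => ?_, Δ, hΔ, fun R R' A B => ?_⟩
  · simpa [QCDRegularisation.scheme_mq, ha, hmc, hZ] using hk
  · obtain ⟨C, hC⟩ := hgap R R' A B
    refine ⟨C, hC.mono fun k hk S hS n hn => ?_⟩
    have hS' : (reg.scheme m 0 0).L k ≤ S := (hL k).trans (by simpa [QCDRegularisation.scheme] using hS)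
    simpa [QCDRegularisation.scheme, ha, hβ, hmc, hZ] using hk S hS' n hn

end Glue

/-! ## §4 The composition (sorry-free) -/

/-- **`ChiralCalibratedConvergence` from the four stubs.** -/
theorem ChiralCalibratedConvergence_of :
    __Registered.stub_chiralGoldstoneSubsequence → __Registered.stub_goldstoneVolumeUpgrade →
      __Registered.stub_calibratedControl → __Registered.stub_diagonalExtraction →
        ChiralCalibratedConvergence := by
  intro hA hV hB hX Nf hNf reg hms hchi has hgap
  -- (A) the Goldstone subsequence `reg₀ := reg.restrict φ₀`
  obtain ⟨φ₀, hφ₀, hG₀⟩ := hA Nf hNf reg hms hchi has hgap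
  have hms₀ := hasMassScaling_restrict reg φ₀ hφ₀ hms
  have has₀ := hasAsymptoticScaling_restrict reg φ₀ hφ₀ has
  have hgap₀ := gapData_restrict reg φ₀ hφ₀ hgap
  -- (V) the volume upgrade `reg₁` (same bare data, larger polynomial volumes, Goldstone bound)
  obtain ⟨reg₁, ha₁, hβ₁, hmc₁, hZ₁, hL₁, hpoly₁, hG₁⟩ :=
    hV Nf hNf (reg.restrict φ₀ hφ₀.tendsto_atTop) has₀ hgap₀ hG₀
  have hms₁ : reg₁.HasMassScaling := hasMassScaling_of_eq ha₁ hZ₁ hms₀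
  have has₁ : (reg₁.scheme 0 0 0).HasAsymptoticScaling := hasAsymptoticScaling_of_eq ha₁ hβ₁ has₀
  have hgap₁ : GapData reg₁ := gapData_of_eq_of_le ha₁ hβ₁ hmc₁ hZ₁ hL₁ hgap₀
  -- (B1) calibrated control on `reg₁`
  obtain ⟨𝒞, hlive, htight, hlip⟩ := hB Nf hNf reg₁ hms₁ has₁ hgap₁ hG₁ hpoly₁
  -- (B2) the diagonal extraction `ψ`, the family `𝒞₂` over `reg₁.restrict ψ`
  obtain ⟨ψ, hψ, 𝒞₂, hall⟩ := hX Nf reg₁ 𝒞 hlive htight hlip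
  refine ⟨φ₀ ∘ ψ, reg₁.restrict ψ hψ.tendsto_atTop, hφ₀.comp hψ, ?_, ?_, ?_, ?_, fun k => ?_,
    (hG₁.restrict ψ hψ.tendsto_atTop).isChiralAtZero, 𝒞₂, fun m hm => ?_⟩
  · funext k; simp [ha₁]
  · funext k; simp [hβ₁]
  · funext k; simp [hmc₁]
  · funext k; simp [hZ₁]
  · simpa using hL₁ (ψ k)
  · obtain ⟨⟨hb₁, hb₂⟩, hk₃, hconv⟩ := hall m hm
    exact ⟨hb₁, hb₂, hk₃, hconv⟩

/-- The crux along this line, from the registered stubs (sorries only inside the four `stub_*`). -/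
theorem chiralCalibratedConvergence_of_stubs : ChiralCalibratedConvergence :=
  ChiralCalibratedConvergence_of stub_chiralGoldstoneSubsequence stub_goldstoneVolumeUpgrade
    stub_calibratedControl stub_diagonalExtraction

/-- Shape record over the UNALIASED statements: the four stub signatures compose to the crux BY NAME. -/
example : ChiralGoldstoneSubsequence → GoldstoneVolumeUpgrade → CalibratedControl → DiagonalExtraction →
    Summit.QuantumFields.QCD.Theses.CounterexampleMustBeHot.ChiralCalibratedConvergence :=
  ChiralCalibratedConvergence_of

end Summit.QuantumFields.QCD.Cruxes.ChiralContinuumComplement.ChiralSubsequence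

end
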